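/-
Copyright (c) 2026. All rights reserved.
Released under Apache 2.0 license as described in the file LICENSE.
Authors: abc-iut cell, prover seat abc-iut-rp-x2 (branch B → R-H hand, gen 5).
-/
import Literature.IUT.LogVolume.UnitLogValuationProfileBelowTies
import HarnessLib

/-!
# The valuation profile of `log_p(𝒪_K^×)`, sequel: an element with UNRAMIFIED UNIT PART is not a logarithm
# on a `U`-level (the «digit lemma»)

Proof-only sequel (theorems, no definitions, no named fact) of `UnitLogValuationProfileBelowTies.lean`
(abc-iut-rp-x2 gen 4), abc-iut-c312-3's `UnitLogValuationSpectrum.lean` (`LogEnvelope.*`: the level-`s`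
envelope `N(s) = min_a (s·pᵃ − e·a)`) and abc-iut-w5-d017's `LogSeriesDominantTerm.lean` (termwise norms
`‖(1−y)ⁿ/n‖ = ‖ϖ‖^{s·n − e·v_p(n)}`, the isosceles read-out), all consumed BY NAME.  Setting: `K` a proper
ultrametric normed `ℚ_p`-algebra field, `e = absRamificationIdx p K`, `ϖ` a norm uniformizer, `ε := ϖ^e/p`.

THE POINT.  The SPECTRUM of `log_p(𝒪_K^×)` (which norms `‖ϖ‖ʳ` occur) decides a log-shell cell only when `r`
misses the spectrum; at a spectrum value `r = N(i₀)` the cell is ELEMENT-dependent (`‖log_p(1 + ϖ^{i₀})‖ = ‖ϖ‖^{N(i₀)}`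
is attained).  This file decides such cells for elements whose UNIT PART IS UNRAMIFIED: let `A ⊆ K` be an
«unramified part» — abstractly, a subring whose nonzero elements have norms in `‖ϖ‖^{eℤ}` (`hA`) and which meets
every residue class of `𝒪_K` (`hres`), containing `ε` — and `x = ϖˢ·ω` with `ω ∈ A` a unit, `s = i₀·p − e` the
exponent of the `p`-th term at level `i₀`.  If the `p`-th term is the UNIQUE dominant term at level `i₀` and the
SECOND scale `s₂` (the next-smallest term exponent, attained at ONE index `n₁ + 1 ≠ p`) satisfies
`s < s₂ < s + min(p, e)`, and the levels below `i₀` are tie-free, then **`x ∉ log_p(𝒪_K^×)`**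
(`not_mem_logUnits_of_unramifiedUnitPart`; series level `logSeries_ne_unramifiedUnitPart`):

* a log-unit `log_p u = m⁻¹·L(uᵐ)` of norm `‖ϖ‖ˢ` must come from `y = uᵐ` of level EXACTLY `i₀` (lower tie-free
  levels are read exactly and give smaller exponents; higher levels give exponents `≥ s + 1`);
* write `1 − y = ϖ^{i₀}·c`, `‖c‖ = 1`; the `p`-th term is `−ϖˢ·ε·cᵖ`, so `L(y) + (1−y)ᵖ/p = ϖˢ·(m·ω + ε·cᵖ)` has norm
  `‖ϖ‖^{s₂}` EXACTLY (second dominant term, `norm_logSeries_sub_term_eq_zpow`), i.e. `‖m·ω + ε·cᵖ‖ = ‖ϖ‖^{s₂−s}`;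
* pick `c₀ ∈ A` with `‖c − c₀‖ < 1`; then `‖cᵖ − c₀ᵖ‖ ≤ max(‖p‖·‖c − c₀‖, ‖c − c₀‖ᵖ) ≤ ‖ϖ‖^{min(p, e+1)}`
  (`norm_pow_prime_sub_pow_prime_le`, from Mathlib's `add_pow_prime_eq`), which is `< ‖ϖ‖^{s₂−s}`; hence the
  element `m·ω + ε·c₀ᵖ ∈ A` has norm `‖ϖ‖^{s₂−s}` with `0 < s₂ − s < e` — not in `‖ϖ‖^{eℤ}`, contradiction.

(The bound `min(p, e)`, not `min(p, e+1)`: an element of `A` MAY have norm `‖ϖ‖ᵉ`.)  The finitary form (second scale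
= the `n = 1` term) and the parameter rows of the abc-iut R-H table are in `UnitLogUnramifiedUnitPartChecks.lean`.
Classical `p`-adic analysis (Neukirch, *Algebraic Number Theory* II (5.5); the binomial congruence is folklore).
Nothing here is disputed mathematics; no IUT statement is asserted; nothing bears on [IUTchIII] Cor. 3.12.
-/

noncomputable section

open Metric Set

namespace Literature.IUT.LogVolume

namespace ValuationProfile

open Literature.NumberTheory.GaloisRepresentations.Ultrametric RamificationCriterion LogEnvelope

/-! ### §1. Two analytic lemmas: `p`-th powers of congruent integers; the second dominant term -/

section Field

variable (p : ℕ) [hp : Fact p.Prime]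
variable {K : Type*} [NontriviallyNormedField K] [instK : NormedAlgebra ℚ_[p] K] [IsUltrametricDist K]
  [ProperSpace K]

omit instK [ProperSpace K] in
/-- **`p`-th powers of congruent integers**: for `‖c‖ ≤ 1`, `‖c₀‖ ≤ 1`,
`‖cᵖ − c₀ᵖ‖ ≤ max (‖p‖·‖c − c₀‖) (‖c − c₀‖ᵖ)` — from `(c₀ + δ)ᵖ = c₀ᵖ + δᵖ + p·c₀·δ·(integer)` (Mathlib
`add_pow_prime_eq`) and the ultrametric inequality. [cite: NeukirchANT1999, Ch. II (5.5)] -/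
theorem norm_pow_prime_sub_pow_prime_le {c c₀ : K} (hc : ‖c‖ ≤ 1) (hc₀ : ‖c₀‖ ≤ 1) :
    ‖c ^ p - c₀ ^ p‖ ≤ max (‖(p : K)‖ * ‖c - c₀‖) (‖c - c₀‖ ^ p) := by
  obtain ⟨δ, rfl⟩ : ∃ δ, c = c₀ + δ := ⟨c - c₀, by ring⟩
  rw [add_sub_cancel_left]
  have hδ1 : ‖δ‖ ≤ 1 := by
    have h := IsUltrametricDist.norm_add_le_max (c₀ + δ) (-c₀)
    rw [norm_neg, show c₀ + δ + -c₀ = δ from by ring] at h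
    exact h.trans (max_le hc hc₀)
  set S : K := ∑ k ∈ Finset.Ioo 0 p, c₀ ^ (k - 1) * δ ^ (p - k - 1) * ((p.choose k / p : ℕ) : K)
    with hS_def
  have hS : ‖S‖ ≤ 1 := by
    refine IsUltrametricDist.norm_sum_le_of_forall_le_of_nonneg zero_le_one fun k _ => ?_
    rw [norm_mul, norm_mul, norm_pow, norm_pow]
    exact mul_le_one₀ (mul_le_one₀ (pow_le_one₀ (norm_nonneg _) hc₀) (pow_nonneg (norm_nonneg _) _)
      (pow_le_one₀ (norm_nonneg _) hδ1)) (norm_nonneg _) (IsUltrametricDist.norm_natCast_le_one K _)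
  have key : (c₀ + δ) ^ p - c₀ ^ p = δ ^ p + (p : K) * c₀ * δ * S := by
    rw [hS_def, add_pow_prime_eq hp.out c₀ δ]
    ring
  rw [key]
  have h2 : ‖(p : K) * c₀ * δ * S‖ ≤ ‖(p : K)‖ * ‖δ‖ := by
    rw [norm_mul, norm_mul, norm_mul]
    calc ‖(p : K)‖ * ‖c₀‖ * ‖δ‖ * ‖S‖ ≤ ‖(p : K)‖ * 1 * ‖δ‖ * 1 := by gcongr
      _ = ‖(p : K)‖ * ‖δ‖ := by ring
  calc ‖δ ^ p + (p : K) * c₀ * δ * S‖ ≤ max ‖δ ^ p‖ ‖(p : K) * c₀ * δ * S‖ :=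
        IsUltrametricDist.norm_add_le_max _ _
    _ ≤ max (‖δ‖ ^ p) (‖(p : K)‖ * ‖δ‖) := by rw [norm_pow]; exact max_le_max le_rfl h2
    _ = max (‖(p : K)‖ * ‖δ‖) (‖δ‖ ^ p) := max_comm _ _

/-- **The SECOND dominant term decides the norm of the series minus the first**: for a principal `y` with
`‖1 − y‖ = ‖ϖ‖ⁱ`, if the term of index `n₁ + 1` has exponent `N₁` and every index `∉ {n₀ + 1, n₁ + 1}` has exponent
`≥ N₁ + 1`, then `‖L(y) − (−(1−y)^{n₀+1}/(n₀+1))‖ = ‖ϖ‖^{N₁}` (isosceles principle on the series with the term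
`n₀ + 1` removed; companion of `norm_logSeries_eq_zpow_of_dominant`). [cite: NeukirchANT1999, Ch. II (5.5)] -/
theorem norm_logSeries_sub_term_eq_zpow {ϖ : Kˣ} (hϖ : IsUniformizer ϖ) {y : K} (hyP : IsPrincipal y)
    {i : ℤ} (hy : ‖1 - y‖ = ‖(ϖ : K)‖ ^ i) (n₀ n₁ : ℕ) (hne : n₁ ≠ n₀) {N₁ : ℤ}
    (h₁ : i * ((n₁ + 1 : ℕ) : ℤ) - (absRamificationIdx p K : ℤ) * (padicValNat p (n₁ + 1) : ℤ) = N₁)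
    (h : ∀ n : ℕ, n ≠ n₀ → n ≠ n₁ →
      N₁ + 1 ≤ i * ((n + 1 : ℕ) : ℤ) - (absRamificationIdx p K : ℤ) * (padicValNat p (n + 1) : ℤ)) :
    ‖logSeries y - -((1 - y) ^ (n₀ + 1)) / (n₀ + 1 : K)‖ = ‖(ϖ : K)‖ ^ N₁ := by
  classical
  have hρ0 : 0 < ‖(ϖ : K)‖ := norm_units_pos ϖ
  set f : ℕ → K := fun n ↦ -((1 - y) ^ (n + 1)) / (n + 1 : K) with hf
  have hsum : HasSum f (logSeries y) := hasSum_logSeries p hyP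
  have hsum₀ : HasSum (fun n ↦ if n = n₀ then 0 else f n) (logSeries y - f n₀) :=
    hasSum_ite_sub_hasSum hsum n₀
  have hsum₁ : HasSum (fun n ↦ if n = n₁ then 0 else if n = n₀ then 0 else f n)
      (logSeries y - f n₀ - f n₁) := by
    have h' := hasSum_ite_sub_hasSum hsum₀ n₁
    simp only [if_neg hne] at h'
    exact h'
  have hterm : ∀ n, ‖f n‖ = ‖(ϖ : K)‖ ^
      (i * ((n + 1 : ℕ) : ℤ) - (absRamificationIdx p K : ℤ) * (padicValNat p (n + 1) : ℤ)) :=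
    fun n ↦ norm_logTerm_eq_zpow p hϖ hy n
  have hmain : ‖f n₁‖ = ‖(ϖ : K)‖ ^ N₁ := by rw [hterm n₁, h₁]
  have hrest : ‖logSeries y - f n₀ - f n₁‖ ≤ ‖(ϖ : K)‖ ^ (N₁ + 1) := by
    rw [← hsum₁.tsum_eq]
    refine IsUltrametricDist.norm_tsum_le_of_forall_le_of_nonneg (zpow_pos hρ0 _).le fun n ↦ ?_
    by_cases hn1 : n = n₁
    · rw [if_pos hn1, norm_zero]; exact (zpow_pos hρ0 _).le
    by_cases hn0 : n = n₀
    · rw [if_neg hn1, if_pos hn0, norm_zero]; exact (zpow_pos hρ0 _).le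
    · rw [if_neg hn1, if_neg hn0, hterm n]
      exact zpow_le_zpow_right_of_le_one₀ hρ0 hϖ.1.le (h n hn0 hn1)
  have hlt : ‖logSeries y - f n₀ - f n₁‖ < ‖f n₁‖ := by
    rw [hmain]
    exact hrest.trans_lt (zpow_lt_zpow_right_of_lt_one₀ hρ0 hϖ.1 (lt_add_one N₁))
  have hsplit : logSeries y - f n₀ = f n₁ + (logSeries y - f n₀ - f n₁) := by ring
  show ‖logSeries y - f n₀‖ = _
  rw [hsplit, IsUltrametricDist.norm_add_eq_max_of_norm_ne_norm (ne_of_gt hlt), max_eq_left hlt.le, hmain]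

/-! ### §2. The digit lemma: an unramified unit part is not a logarithm on a `U`-level -/

/-- **DIGIT LEMMA, series level.**  `A ⊆ K` an «unramified part» (subring; nonzero elements have norms in
`‖ϖ‖^{eℤ}`; meets every residue class of `𝒪_K`; contains `ε = ϖ^e/p`), `ω ∈ A` a unit; `s = i₀·p − e` the exponent
of the `p`-th term at level `i₀ ≥ 1`, the second scale `s₂` attained at the single index `n₁ + 1 ≠ p` and every
other index `∉ {p, n₁+1}` of exponent `≥ s₂ + 1`, `s < s₂ < s + min(p, e)`, and the levels `1, …, i₀ − 1` tie-free.
Then **`L(y) ≠ ϖˢ·ω` for EVERY principal unit `y`.** [cite: NeukirchANT1999, Ch. II (5.5)] -/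
theorem logSeries_ne_unramifiedUnitPart {ϖ : Kˣ} (hϖ : IsUniformizer ϖ) (A : Subring K)
    (hA : ∀ z ∈ A, z ≠ 0 → ∃ k : ℤ, ‖z‖ = ‖(ϖ : K)‖ ^ ((absRamificationIdx p K : ℤ) * k))
    (hres : ∀ c : K, ‖c‖ ≤ 1 → ∃ c₀ ∈ A, ‖c - c₀‖ < 1)
    (hε : (ϖ : K) ^ absRamificationIdx p K / (p : K) ∈ A)
    {ω : K} (hωA : ω ∈ A) (hω : ‖ω‖ = 1)
    {i₀ s s₂ : ℤ} (hs : i₀ * (p : ℤ) - (absRamificationIdx p K : ℤ) = s)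
    {n₁ : ℕ} (hn₁ : n₁ + 1 ≠ p)
    (hs₂ : i₀ * ((n₁ + 1 : ℕ) : ℤ) - (absRamificationIdx p K : ℤ) * (padicValNat p (n₁ + 1) : ℤ) = s₂)
    (hsec : ∀ n : ℕ, n + 1 ≠ p → n ≠ n₁ →
      s₂ + 1 ≤ i₀ * ((n + 1 : ℕ) : ℤ) - (absRamificationIdx p K : ℤ) * (padicValNat p (n + 1) : ℤ))
    (hlt : s < s₂) (hsp : s₂ < s + p) (hse : s₂ < s + absRamificationIdx p K)
    (htie : ∀ i : ℤ, 1 ≤ i → i < i₀ → ∀ b : ℕ,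
      (absRamificationIdx p K : ℤ) ≠ i * (p : ℤ) ^ b * ((p : ℤ) - 1))
    {y : K} (hyP : IsPrincipal y) : logSeries y ≠ (ϖ : K) ^ s * ω := by
  intro hEq
  have hρ0 : 0 < ‖(ϖ : K)‖ := norm_units_pos ϖ
  have hρ1 : ‖(ϖ : K)‖ < 1 := hϖ.1
  have hP : (2 : ℤ) ≤ (p : ℤ) := by exact_mod_cast hp.out.two_le
  have hp0 : (p : K) ≠ 0 := prime_ne_zero p K
  set e : ℕ := absRamificationIdx p K with he_def
  have hpe : ‖(p : K)‖ = ‖(ϖ : K)‖ ^ e := norm_prime_eq_norm_pow p K hϖ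
  -- the target has norm `‖ϖ‖ˢ`
  have hxnorm : ‖(ϖ : K) ^ s * ω‖ = ‖(ϖ : K)‖ ^ s := by rw [norm_mul, norm_zpow, hω, mul_one]
  have hLnorm : ‖logSeries y‖ = ‖(ϖ : K)‖ ^ s := by rw [hEq, hxnorm]
  -- `y ≠ 1`, so `y` has a level `i ≥ 1`
  have hy1 : y ≠ 1 := by
    intro h1
    rw [h1, logSeries_one, norm_zero] at hLnorm
    exact (zpow_pos hρ0 s).ne hLnorm
  have hx : (1 : K) - y ≠ 0 := sub_ne_zero.mpr (Ne.symm hy1)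
  obtain ⟨i, hi⟩ := hϖ.2 (Units.mk0 (1 - y) hx)
  rw [Units.val_mk0] at hi
  have hi1 : 1 ≤ i := by
    have h1 : ‖(ϖ : K)‖ ^ i < 1 := hi ▸ hyP
    have := (zpow_lt_one_iff_right_of_lt_one₀ hρ0 hρ1).mp h1
    omega
  -- every exponent at level `i₀` is `≥ s`
  have hexp_ge : ∀ n : ℕ, s ≤ i₀ * ((n + 1 : ℕ) : ℤ) - (e : ℤ) * (padicValNat p (n + 1) : ℤ) := by
    intro n
    by_cases hnp : n + 1 = p
    · rw [hnp, padicValNat_self]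
      push_cast
      linarith
    by_cases hnn : n = n₁
    · subst hnn
      rw [hs₂]
      exact hlt.le
    · have := hsec n hnp hnn
      linarith
  -- Step 1: the level of `y` is exactly `i₀`
  have hii₀ : i = i₀ := by
    rcases lt_trichotomy i i₀ with hlt' | heq | hgt
    · -- `i < i₀`: tie-free level, `‖L(y)‖ = ‖ϖ‖^{N(i)}` with `N(i) ≤ i·p − e < s`
      exfalso
      obtain ⟨a₀, hlo, hhi⟩ := exists_turning_level (p := p) hi1 e
      have hhi' : (e : ℤ) < i * (p : ℤ) ^ a₀ * ((p : ℤ) - 1) :=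
        lt_of_le_of_ne hhi (htie i hi1 hlt' a₀)
      have hnorm := norm_logSeries_eq_zpow_level p hϖ hi1 hlo hhi' hi
      have hmin := exponent_min (a₀ := a₀) hi1 hP hlo hhi 1
      rw [pow_one, Nat.cast_one, mul_one] at hmin
      have hip : i * (p : ℤ) < i₀ * (p : ℤ) := mul_lt_mul_of_pos_right hlt' (by linarith)
      have hlt2 : i * (p : ℤ) ^ a₀ - (e : ℤ) * (a₀ : ℤ) < s := by linarith
      rw [hLnorm] at hnorm
      exact absurd (zpow_right_injective₀ hρ0 hρ1.ne hnorm) (ne_of_gt hlt2)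
    · exact heq
    · -- `i > i₀`: every term has exponent `≥ s + 1`
      exfalso
      have hle : ‖logSeries y‖ ≤ ‖(ϖ : K)‖ ^ (s + 1) := by
        refine norm_logSeries_le (zpow_pos hρ0 _).le fun n => ?_
        rw [norm_logTerm_eq_zpow p hϖ hi n]
        refine zpow_le_zpow_right_of_le_one₀ hρ0 hρ1.le ?_
        have h1 := hexp_ge n
        have hn1 : (1 : ℤ) ≤ ((n + 1 : ℕ) : ℤ) := by exact_mod_cast Nat.succ_pos n
        have h2 : (i₀ + 1) * ((n + 1 : ℕ) : ℤ) ≤ i * ((n + 1 : ℕ) : ℤ) :=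
          mul_le_mul_of_nonneg_right (by omega) (by positivity)
        nlinarith
      rw [hLnorm] at hle
      exact absurd hle (not_le.mpr (zpow_lt_zpow_right_of_lt_one₀ hρ0 hρ1 (lt_add_one s)))
  rw [hii₀] at hi
  -- Step 2: the `p`-th term.  `1 − y = ϖ^{i₀}·c` with `‖c‖ = 1`
  set c : K := (1 - y) * ((ϖ : K) ^ i₀)⁻¹ with hc_def
  have hzi : (ϖ : K) ^ i₀ ≠ 0 := zpow_ne_zero _ ϖ.ne_zero
  have hc1 : ‖c‖ = 1 := by
    rw [hc_def, norm_mul, norm_inv, norm_zpow, hi, mul_inv_cancel₀ (zpow_ne_zero _ hρ0.ne')]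
  have hY : (1 : K) - y = (ϖ : K) ^ i₀ * c := by
    rw [hc_def, mul_left_comm, mul_inv_cancel₀ hzi, mul_one]
  set ε : K := (ϖ : K) ^ e / (p : K) with hε_def
  have hεnorm : ‖ε‖ = 1 := by
    rw [hε_def, norm_div, norm_pow, hpe, div_self (pow_ne_zero _ hρ0.ne')]
  obtain ⟨n₀, hn₀⟩ : ∃ n₀ : ℕ, n₀ + 1 = p := ⟨p - 1, Nat.sub_add_cancel hp.out.one_le⟩
  have hn₀K : ((n₀ : K) + 1) = (p : K) := by rw [← hn₀, Nat.cast_succ]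
  have hzpow : (ϖ : K) ^ (i₀ * (p : ℤ)) = (ϖ : K) ^ s * (ϖ : K) ^ e := by
    rw [← zpow_natCast (ϖ : K) e, ← zpow_add₀ ϖ.ne_zero, show s + (e : ℤ) = i₀ * (p : ℤ) from by linarith]
  have hpt : -((1 - y) ^ (n₀ + 1)) / (n₀ + 1 : K) = -((ϖ : K) ^ s * (ε * c ^ p)) := by
    rw [hn₀K, hn₀, hY, mul_pow, ← zpow_natCast ((ϖ : K) ^ i₀) p, ← zpow_mul, hzpow, hε_def]
    ring
  -- the second dominant term: `‖L(y) − (p-th term)‖ = ‖ϖ‖^{s₂}`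
  have hne₁ : n₁ ≠ n₀ := fun h => hn₁ (by omega)
  have hsecond := norm_logSeries_sub_term_eq_zpow p hϖ hyP hi n₀ n₁ hne₁ hs₂
    (fun n hn0 hnn1 => hsec n (fun h => hn0 (by omega)) hnn1)
  have hdiff : logSeries y - -((1 - y) ^ (n₀ + 1)) / (n₀ + 1 : K) = (ϖ : K) ^ s * (ω + ε * c ^ p) := by
    rw [hpt, hEq]
    ring
  have hnorm1 : ‖ω + ε * c ^ p‖ = ‖(ϖ : K)‖ ^ (s₂ - s) := by
    rw [hdiff, norm_mul, norm_zpow] at hsecond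
    rw [zpow_sub₀ hρ0.ne', eq_div_iff (zpow_ne_zero _ hρ0.ne'), mul_comm]
    exact hsecond
  -- Step 3: replace `c` by an unramified `c₀ ≡ c (mod ϖ)`
  obtain ⟨c₀, hc₀A, hcc₀⟩ := hres c hc1.le
  have hc₀1 : ‖c₀‖ ≤ 1 := by
    have h := IsUltrametricDist.norm_add_le_max c (-(c - c₀))
    rw [norm_neg, show c + -(c - c₀) = c₀ from by ring] at h
    exact h.trans (max_le hc1.le hcc₀.le)
  have hδ : ‖c - c₀‖ ≤ ‖(ϖ : K)‖ := by
    by_cases h0 : c - c₀ = 0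
    · rw [h0, norm_zero]; exact hρ0.le
    · obtain ⟨k, hk⟩ := hϖ.2 (Units.mk0 _ h0)
      rw [Units.val_mk0] at hk
      have hk1 : 1 ≤ k := by
        have h1 : ‖(ϖ : K)‖ ^ k < 1 := hk ▸ hcc₀
        have := (zpow_lt_one_iff_right_of_lt_one₀ hρ0 hρ1).mp h1
        omega
      rw [hk]
      calc ‖(ϖ : K)‖ ^ k ≤ ‖(ϖ : K)‖ ^ (1 : ℤ) := zpow_le_zpow_right_of_le_one₀ hρ0 hρ1.le hk1
        _ = ‖(ϖ : K)‖ := zpow_one _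
  have herr : ‖ε * (c ^ p - c₀ ^ p)‖ < ‖(ϖ : K)‖ ^ (s₂ - s) := by
    rw [norm_mul, hεnorm, one_mul]
    refine (norm_pow_prime_sub_pow_prime_le p hc1.le hc₀1).trans_lt (max_lt ?_ ?_)
    · calc ‖(p : K)‖ * ‖c - c₀‖ ≤ ‖(ϖ : K)‖ ^ e * ‖(ϖ : K)‖ := by rw [hpe]; gcongr
        _ = ‖(ϖ : K)‖ ^ ((e : ℤ) + 1) := by rw [zpow_add_one₀ hρ0.ne', zpow_natCast]
        _ < ‖(ϖ : K)‖ ^ (s₂ - s) := zpow_lt_zpow_right_of_lt_one₀ hρ0 hρ1 (by linarith)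
    · calc ‖c - c₀‖ ^ p ≤ ‖(ϖ : K)‖ ^ p := pow_le_pow_left₀ (norm_nonneg _) hδ p
        _ = ‖(ϖ : K)‖ ^ (p : ℤ) := (zpow_natCast _ _).symm
        _ < ‖(ϖ : K)‖ ^ (s₂ - s) := zpow_lt_zpow_right_of_lt_one₀ hρ0 hρ1 (by linarith)
  -- the element `ω + ε·c₀ᵖ ∈ A` has norm `‖ϖ‖^{s₂ − s}`, `0 < s₂ − s < e`: contradiction
  have hz : ω + ε * c₀ ^ p = (ω + ε * c ^ p) + -(ε * (c ^ p - c₀ ^ p)) := by ring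
  have hb : ‖-(ε * (c ^ p - c₀ ^ p))‖ < ‖ω + ε * c ^ p‖ := by
    rw [norm_neg, hnorm1]
    exact herr
  have hznorm : ‖ω + ε * c₀ ^ p‖ = ‖(ϖ : K)‖ ^ (s₂ - s) := by
    rw [hz, IsUltrametricDist.norm_add_eq_max_of_norm_ne_norm (ne_of_gt hb), max_eq_left hb.le, hnorm1]
  have hzA : ω + ε * c₀ ^ p ∈ A := A.add_mem hωA (A.mul_mem hε (A.pow_mem hc₀A p))
  have hz0 : ω + ε * c₀ ^ p ≠ 0 := by
    intro h0
    rw [h0, norm_zero] at hznorm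
    exact (zpow_pos hρ0 _).ne hznorm
  obtain ⟨k, hk⟩ := hA _ hzA hz0
  rw [hznorm] at hk
  have hk' : s₂ - s = (e : ℤ) * k := zpow_right_injective₀ hρ0 hρ1.ne hk
  have h1 : 0 < (e : ℤ) * k := by rw [← hk']; linarith
  have h2 : (e : ℤ) * k < e := by rw [← hk']; linarith
  have he0 : (0 : ℤ) < e := by exact_mod_cast absRamificationIdx_pos p K
  have hk0 : 0 < k := pos_of_mul_pos_right h1 he0.le
  nlinarith

/-- **DIGIT LEMMA: an element `ϖˢ·ω` with UNRAMIFIED unit part `ω` is not a `log_p` of a unit** (hypotheses as in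
`logSeries_ne_unramifiedUnitPart`; reduction `log_p u = m⁻¹·L(uᵐ)`, `p ∤ m`, `m·ω ∈ A` again a unit).
[cite: NeukirchANT1999, Ch. II (5.5)] -/
theorem not_mem_logUnits_of_unramifiedUnitPart {ϖ : Kˣ} (hϖ : IsUniformizer ϖ) (A : Subring K)
    (hA : ∀ z ∈ A, z ≠ 0 → ∃ k : ℤ, ‖z‖ = ‖(ϖ : K)‖ ^ ((absRamificationIdx p K : ℤ) * k))
    (hres : ∀ c : K, ‖c‖ ≤ 1 → ∃ c₀ ∈ A, ‖c - c₀‖ < 1)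
    (hε : (ϖ : K) ^ absRamificationIdx p K / (p : K) ∈ A)
    {ω : K} (hωA : ω ∈ A) (hω : ‖ω‖ = 1)
    {i₀ s s₂ : ℤ} (hs : i₀ * (p : ℤ) - (absRamificationIdx p K : ℤ) = s)
    {n₁ : ℕ} (hn₁ : n₁ + 1 ≠ p)
    (hs₂ : i₀ * ((n₁ + 1 : ℕ) : ℤ) - (absRamificationIdx p K : ℤ) * (padicValNat p (n₁ + 1) : ℤ) = s₂)
    (hsec : ∀ n : ℕ, n + 1 ≠ p → n ≠ n₁ →
      s₂ + 1 ≤ i₀ * ((n + 1 : ℕ) : ℤ) - (absRamificationIdx p K : ℤ) * (padicValNat p (n + 1) : ℤ))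
    (hlt : s < s₂) (hsp : s₂ < s + p) (hse : s₂ < s + absRamificationIdx p K)
    (htie : ∀ i : ℤ, 1 ≤ i → i < i₀ → ∀ b : ℕ,
      (absRamificationIdx p K : ℤ) ≠ i * (p : ℤ) ^ b * ((p : ℤ) - 1)) :
    (ϖ : K) ^ s * ω ∉ logUnits K := by
  intro hmem
  have hρ0 : 0 < ‖(ϖ : K)‖ := norm_units_pos ϖ
  have hx0 : (ϖ : K) ^ s * ω ≠ 0 := by
    intro h0
    have h := congrArg (‖·‖) h0
    simp only [norm_mul, norm_zpow, hω, mul_one, norm_zero] at h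
    exact (zpow_pos hρ0 s).ne' h
  obtain ⟨u, m, -, -, hm0, hmp, hmP, -, -, hlog⟩ := exists_level_of_mem_logUnits p hϖ hmem hx0
  have hm1 : ‖(m : K)‖ = 1 := norm_natCast_eq_one_of_not_dvd p hmp
  have hm0' : (m : K) ≠ 0 := by
    intro h0
    rw [h0, norm_zero] at hm1
    exact zero_ne_one hm1
  have hL : logSeries (u ^ m) = (ϖ : K) ^ s * ((m : K) * ω) := by
    have h := unitLog_eq_inv_mul_logSeries p hm0 hmP
    rw [hlog] at h
    calc logSeries (u ^ m) = (m : K) * (((m : ℕ) : K)⁻¹ * logSeries (u ^ m)) := by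
          rw [← mul_assoc, mul_inv_cancel₀ hm0', one_mul]
      _ = (m : K) * ((ϖ : K) ^ s * ω) := by rw [← h]
      _ = (ϖ : K) ^ s * ((m : K) * ω) := by ring
  have hmω : ‖(m : K) * ω‖ = 1 := by rw [norm_mul, hm1, hω, one_mul]
  exact logSeries_ne_unramifiedUnitPart p hϖ A hA hres hε (A.mul_mem (natCast_mem A m) hωA) hmω hs hn₁
    hs₂ hsec hlt hsp hse htie hmP hL

end Field

end ValuationProfile

end Literature.IUT.LogVolume

end
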